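import Summits.BirchSwinnertonDyer.BirchSwinnertonDyer.Theorems.AdditiveKolyvaginRoadManinFrameResidueProperRTameTwistSymbols
import Literature.NumberTheory.EllipticCurves.ManinConstantClassCertificateTwist
import Summits.BirchSwinnertonDyer.Rank1Residual.X12.InertCoreEveryCurve
import HarnessLib

/-!
# Route `AdditiveKolyvaginRoad`, crux `ManinFrameResidueProperR` (stmt-BirchSwinnertonDyer-20709), line
# `birth`, stub TDS `stub_twistDegreeStep` (`p ≥ 11`): the TAME-TWIST lever — Manin's `p`-part at every
# lattice-optimal datum from Kato's integral zeta elements read in Néron units for ALL tame characters,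
# on the locus «no multiplicative prime `ℓ ∥ N` with `ord_p(ℓ/a_ℓ)` a power of `2`» — `--supports`, helper

Cell `pub/bsd-wall` (D-0120, W-ALL row 2), seat `bsd-wall-manin-p1` g3. THEOREMS ONLY; the published input
is the Literature fact `Literature.NumberTheory.EllipticCurves.kato_neron_isIntegral_twistedSymbolSum_of_additive`
(a derived reading of printed theorems — the all-characters form of the predecessor's
`kato_neron_padicValRat_twistedSymbolSum_nonneg_of_additive`), cited as the hypothesis `hK`, never asserted.
No `sorry`; nothing is closed (the registered stub TDS is Manin's `p`-part on Edixhoven's exceptional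
locus, open in print). What this file removes from the predecessor's Euler-system lever
(`…ManinFrameResidueProperRUnitTwist.lean`: TDS ⟸ fact ∧ K4, K4 = ONE `p`-unit quadratic twisted value,
uniformly open) is the unit hypothesis K4: no `L`-value needs to be a unit.

THEOREM (`not_dvd_c_of_tameTwist`). `W/ℚ` globally minimal, additive at a prime `p > 7`, `E[p]`
irreducible, `D` a lattice-optimal datum (`Λ_E = c Λ_f`) at a level `N` with `p² ∣ N`, and
**(A²)** for every `ℓ ∥ N`, no `2`-power of `ℓ / a_ℓ(W)` is `1 (mod p)`. GRANTED the fact: `p ∤ c`.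

PROOF. (i) For `γ = (a b; c d) ∈ Γ₀(N)`, `{∞, γ∞}_f = {∞, b/d′}_f − {∞, 0}_f` where `d′ = d + kc` is any
denominator in the class of `d (mod c)` (Manin, tree `modularSymbol_gamma0_smul_holds` applied to `γT^k`);
for ADJUSTABLE `γ` Dirichlet gives such a PRIME `d′ > N` with `p ∤ d′ − 1` and `r ∤ d′ − 1` for every odd
prime `r ∣ p − 1` (`…RTameTwistGamma0`). (ii) Orthogonality over the ODD characters modulo `d′`
(`…RTameTwistArith`) and `{∞, −r}_f = conj {∞, r}_f` give
`Σ_{χ odd} χ(b)⁻¹ Σ_a χ(a){∞, a/d′}_f = (d′ − 1) · i · Im {∞, b/d′}_f` — no `L(E,1)` term, no Hecke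
operator. (iii) Each odd `χ (mod d′)` is primitive, `≠ 1`, of order `∣ d′ − 1` prime to `p`; the fact gives
`∏_{ℓ∥N}(ℓ − a_ℓχ(ℓ))(ℓ − a_ℓχ̄(ℓ)) · Σ_a χ(a){∞,a/d′}_f ∈ 𝓞_(p) · |Ω⁻(W)| i`, and each Euler factor is a
`p`-unit: `(ℓ − a ζ) · Σ ℓ^i(aζ)^{n−1−i} = ℓⁿ − aⁿ` (`n = d′ − 1`) and `p ∣ ℓⁿ − aⁿ` would force
`ord_p(ℓ/a) ∣ gcd(n, p − 1)`, a power of `2`, excluded by (A²). Hence `Im {∞, γ∞}_f ∈ ℤ_(p)|Ω⁻(W)|`.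
(iv) Every `γ`: `γ⁴ = γ₁γ₂` with `γᵢ` adjustable (`…RTameTwistSplit`), `{∞, ·∞}_f` a homomorphism
(`cuspSymbol_mul_holds`), `p ≠ 2`. (v) `Λ_f = {{∞, γ∞}_f}` (`coe_periodLattice_eq_range`), so
`Ω⁻_f/2 ∈ ℤ_(p)|Ω⁻(W)|`, i.e. `ord_p ϖ ≥ 0` for `ϖ|Ω⁻(W)| = Ω⁻_f`; at a lattice-optimal datum
`ord_p ϖ = −ord_p c` (predecessor's `padicValRat_eq_neg_of_mul_imaginaryPeriodRat_eq`). ∎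

COROLLARIES (§4): at an AKR residue frame (`p ≥ 11`, `Addv`, `Irr`) satisfying (A²) — a congruence
condition on `(N, a_ℓ)` alone, an isogeny invariant — the member statement of line `birth` and the
CONCLUSION of `stub_twistDegreeStep` for every `(V, W♭, C)` (via p540328), and the per-curve certificate
`p ∤ c₀` for every lattice-optimal datum of every minimal member. HONEST STATUS: conditional on the
fact (XL to discharge: Kato's explicit reciprocity law); (A²) is a genuine restriction (e.g. void for
Fermat primes `p`; for `p ≡ 3 (4)` it reads `ℓ ≢ ±1 (mod p)` for all `ℓ ∥ N`); the method meets its limit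
at `ℓ ≡ a_ℓ (mod p)` (the Euler factor `ℓ − a_ℓχ(ℓ)` then vanishes mod `p` whenever `χ(ℓ) = 1`).
-/

set_option autoImplicit false
set_option linter.dupNamespace false

noncomputable section

open scoped Classical MatrixGroups

open WeierstrassCurve NumberField Literature.NumberTheory.EllipticCurves
  Literature.NumberTheory.EllipticCurves.ModularForms
  Literature.NumberTheory.EllipticCurves.Rank1Residual
  Literature.NumberTheory.DiophantineGeometry IsDedekindDomain Rat.HeightOneSpectrum
  Summit.BirchSwinnertonDyer.Rank1Residual Summit.BirchSwinnertonDyer.Rank1Residual.Additive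
  CongruenceSubgroup Complex

namespace Summit.BirchSwinnertonDyer.BirchSwinnertonDyer.Theorems.ManinFrameResidueProperRTameTwist

/-! ### §4 Manin's `p`-part at a lattice-optimal datum, and the frame corollaries -/

section Main

variable {p : ℕ} [hp : Fact p.Prime]

/-- `p ∤ c` from `ord_p c ≤ 0` for a non-zero integer `c` (plumbing). [folklore] -/
theorem not_dvd_of_padicValRat_intCast_le_zero {c : ℤ} (hc : c ≠ 0)
    (h : padicValRat p (c : ℚ) ≤ 0) : ¬ (p : ℤ) ∣ c := by
  intro hdvd
  rw [padicValRat.of_int] at h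
  have h2 : padicValInt p c = 0 := by
    have : (padicValInt p c : ℤ) ≤ 0 := by exact_mod_cast h
    omega
  rw [padicValInt, padicValNat.eq_zero_iff] at h2
  rcases h2 with h2 | h2 | h2
  · exact hp.out.one_lt.ne' h2
  · exact (Int.natAbs_eq_zero.not.mpr hc) h2
  · exact h2 (Int.natCast_dvd.mp hdvd)

/-- **Manin's `p`-part at a lattice-optimal datum, from the tame-twist lever.** Let `W/ℚ` be globally
minimal, additive at a prime `p > 7` with `E[p]` irreducible, `D` a LATTICE-OPTIMAL datum
(`Λ_E = c Λ_f`) at a level `N` with `p² ∣ N`, and assume **(A²)**: for every prime `ℓ ∥ N`, no `2`-power of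
`ℓ / a_ℓ(W) (mod p)` equals `1`. GRANTED the all-characters Kato–Kosters–Pannekoek fact: `p ∤ c`.
Proof: `im Λ_f = ℤ·Ω⁻_f/2` is generated by the `Im {∞, γ∞}_f`, all in `ℤ_(p)|Ω⁻(W)|`
(`pint_im_cuspSymbol`), so `ord_p ϖ ≥ 0` for `ϖ |Ω⁻(W)| = Ω⁻_f`, while `ord_p ϖ = −ord_p c` at a
lattice-optimal datum. [cite: Kato2004Asterisque, (8.1.3) (p. 180), Thm. 9.7 (p. 189)]
[cite: KimNakamura2020, Cor. 2.4] [cite: EdixhovenManin1991, §1] -/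
theorem not_dvd_c_of_tameTwist (hK : kato_neron_isIntegral_twistedSymbolSum_of_additive)
    (W : WeierstrassCurve ℚ) [W.IsElliptic] [W.IsGloballyMinimal] {N : ℕ} [NeZero N]
    (D : ModularParametrizationData W N)
    (hopt : ∀ z ∈ D.L.lattice, ∃ w ∈ periodLattice D.f, z = D.c * w) (hp7 : 7 < p)
    (hadd : Addv W p) (hirr : Irr W p) (hpN : p ^ 2 ∣ N)
    (hA : ∀ ℓ ∈ N.primeFactors, ¬ ℓ ^ 2 ∣ N →
      ∀ j : ℕ, ((ℓ : ZMod p) / (W.LFunction ℓ : ZMod p)) ^ 2 ^ j ≠ 1) :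
    ¬ (p : ℤ) ∣ D.c := by
  have hpP : p.Prime := hp.out
  have hp2 : p ≠ 2 := by omega
  have hc0 : D.c ≠ 0 := D.maninConstant_ne_zero_holds
  -- the period scalar `ϖ = m/|c|`
  obtain ⟨mm, -, hmm⟩ :=
    SkinnerUrban2014.exists_dvd_two_mul_imaginaryPeriodRat_eq_of_latticeEq D hopt
  set ϖ : ℚ := (mm : ℚ) / |(D.c : ℚ)| with hϖdef
  have habs0 : |(D.c : ℝ)| ≠ 0 := abs_ne_zero.mpr (by exact_mod_cast hc0)
  have hϖ : (ϖ : ℝ) * W.imaginaryPeriodRat = minusPeriod D.f := by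
    rw [hϖdef]; push_cast
    rw [div_mul_eq_mul_div, hmm]
    field_simp
  have hΩf : 0 < minusPeriod D.f :=
    IsNewform0.minusPeriod_pos_holds D.isNewformOf.1 D.isNewformOf.coeffField_eq_bot
  have hΩ : 0 < W.imaginaryPeriodRat := W.imaginaryPeriodRat_pos
  -- `Ω⁻_f/2 = Im {∞, γ∞}_f` for some `γ`
  have hmem : minusPeriod D.f / 2 ∈ imagPeriods D.f := by
    rw [SkinnerUrban2014.imagPeriods_eq_zmultiples_of_minusPeriod_pos D.f hΩf]
    exact AddSubgroup.mem_zmultiples _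
  obtain ⟨z, hz, hzim⟩ := AddSubgroup.mem_map.mp hmem
  have hz' : z ∈ (periodLattice D.f : Set ℂ) := hz
  rw [coe_periodLattice_eq_range] at hz'
  obtain ⟨γ, hγ⟩ := hz'
  have hP := pint_im_cuspSymbol hK hp7 hadd hirr D.f D.isNewformOf hpN hA hϖ γ
  rw [hγ] at hP
  have hzim' : z.im = minusPeriod D.f / 2 := hzim
  -- `Im z / Ω = ϖ/2`
  have hq : (((z.im : ℝ) : ℂ) / (W.imaginaryPeriodRat : ℂ)) = ((ϖ / 2 : ℚ) : ℂ) := by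
    rw [hzim', ← hϖ]
    have hΩ0 : (W.imaginaryPeriodRat : ℂ) ≠ 0 := by exact_mod_cast hΩ.ne'
    push_cast
    field_simp
  rw [hq] at hP
  have hval := padicValRat_nonneg_of_pint hP
  have hϖ2 : padicValRat p (ϖ / 2) = padicValRat p ϖ := by
    have hϖ0 : ϖ ≠ 0 := by
      rintro h; rw [h, Rat.cast_zero, zero_mul] at hϖ; exact hΩf.ne' hϖ.symm
    rw [padicValRat.div hϖ0 two_ne_zero, show (2 : ℚ) = ((2 : ℕ) : ℚ) by norm_num, padicValRat.of_nat,
      padicValNat.eq_zero_of_not_dvd (fun h ↦ hp2 ((Nat.prime_dvd_prime_iff_eq hpP Nat.prime_two).mp h))]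
    simp
  rw [hϖ2, ManinFrameResidueProperRUnitTwist.padicValRat_eq_neg_of_mul_imaginaryPeriodRat_eq hp2 D hopt hϖ]
    at hval
  exact not_dvd_of_padicValRat_intCast_le_zero hc0 (by linarith)

/-- **At an AKR residue frame: a member with a Manin-unit conductor-level datum** (the member statement of
line `birth`), GRANTED the fact and modularity, on the locus (A²) — `p ≥ 11`, additive, `E[p]` irreducible,
and no multiplicative prime `ℓ ∥ N(W)` with a `2`-power of `ℓ/a_ℓ(W)` equal to `1 (mod p)`: the
`X₀(N)`-optimal member (`X12.exists_isIsogenous_optimal`, lattice-optimal datum) has `p ∤ c₀` by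
`not_dvd_c_of_tameTwist` (`N(W₀) = N(W)`, `a_ℓ(W₀) = a_ℓ(W)`). [cite: EdixhovenManin1991, §4 (cases 1/2)] -/
theorem exists_member_not_dvd_c_of_tameTwist (hK : kato_neron_isIntegral_twistedSymbolSum_of_additive)
    (hnf : exists_isNewformOf) (W : WeierstrassCurve ℚ) [W.IsElliptic] [W.IsGloballyMinimal]
    [NeZero (W.conductorNorm ℤ)] (hp11 : 11 ≤ p) (hadd : Addv W p) (hirr : Irr W p)
    (hA : ∀ ℓ ∈ (W.conductorNorm ℤ).primeFactors, ¬ ℓ ^ 2 ∣ W.conductorNorm ℤ →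
      ∀ j : ℕ, ((ℓ : ZMod p) / (W.LFunction ℓ : ZMod p)) ^ 2 ^ j ≠ 1) :
    ∃ (W₀ : WeierstrassCurve ℚ) (_ : W₀.IsElliptic) (_ : W₀.IsGloballyMinimal)
      (D₀ : ModularParametrizationData W₀ (W.conductorNorm ℤ)),
      IsIsogenous W W₀ ∧ ¬ (p : ℤ) ∣ D₀.c := by
  obtain ⟨W₀, hE₀, hM₀, hNe₀, D₀'', hiso, hN, hopt''⟩ := X12.exists_isIsogenous_optimal hnf W
  haveI := hE₀
  haveI := hM₀
  haveI := hNe₀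
  obtain ⟨D₀', hopt'⟩ := X12.exists_optimalDatum_of_level_eq hN D₀'' hopt''
  have hiso₀ : IsIsogenous W₀ W := hiso.symm_of_charZero
  have hL : W₀.LFunction = W.LFunction := hiso₀.LFunction_eq
  have hadd₀ : Addv W₀ p := (X2.addv_iff_of_isIsogenous (p := p) hiso).mp hadd
  have hirr₀ : Irr W₀ p := (X12.irr_iff_of_isIsogenous hiso p).mp hirr
  have hpN : p ^ 2 ∣ W.conductorNorm ℤ := sq_dvd_conductorNorm_of_not_good_of_not_mult hadd
  rw [← hL] at hA
  exact ⟨W₀, hE₀, hM₀, D₀', hiso, not_dvd_c_of_tameTwist hK W₀ D₀' hopt' (by omega) hadd₀ hirr₀ hpN hA⟩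

/-- **TDS on the locus (A²), from the tame-twist lever.** At an AKR residue frame `(W, p)` — `p ≥ 11`,
additive, `E[p]` irreducible, newform granted (`hnf`) — satisfying (A²), and GRANTED the all-characters
Kato–Kosters–Pannekoek fact: for every unstarred (G)-ordinary globally minimal member `V ∼ W` and every
globally minimal model `W♭` of `V ⊗ χ_{p*}`, SOME conductor-level datum of `V` has strictly fewer factors
`p` in its modular degree than EVERY conductor-level datum of `W♭` — the CONCLUSION of the registered stub
`stub_twistDegreeStep` (Edixhoven 1991 §4, "case 2"), by the predecessor's
`twistDegreeStep_of_exists_member_not_dvd_c` (p540328). Neither the residue clause nor the degree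
clause `hall` of the stub is used; K4 is not used. [cite: EdixhovenManin1991, §4 (cases 1/2)]
[cite: Kato2004Asterisque, Thm. 9.7 (p. 189)] -/
theorem twistDegreeStep_of_tameTwist (hK : kato_neron_isIntegral_twistedSymbolSum_of_additive)
    (hnf : exists_isNewformOf) (W : WeierstrassCurve ℚ) [W.IsElliptic] [W.IsGloballyMinimal]
    [NeZero (W.conductorNorm ℤ)] (hp11 : 11 ≤ p) (hadd : Addv W p) (hirr : Irr W p)
    (hA : ∀ ℓ ∈ (W.conductorNorm ℤ).primeFactors, ¬ ℓ ^ 2 ∣ W.conductorNorm ℤ →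
      ∀ j : ℕ, ((ℓ : ZMod p) / (W.LFunction ℓ : ZMod p)) ^ 2 ^ j ≠ 1)
    (V : WeierstrassCurve ℚ) [V.IsElliptic] [V.IsGloballyMinimal] [NeZero (V.conductorNorm ℤ)]
    (Wf : WeierstrassCurve ℚ) [Wf.IsElliptic] [Wf.IsGloballyMinimal] [NeZero (Wf.conductorNorm ℤ)]
    (C : VariableChange ℚ) (hisoV : IsIsogenous W V) (hG : TypeGOrd V p)
    (hV4 : padicValInt p V.minimalDiscriminantInt ≤ 4)
    (hC : C • V.quadraticTwist ((-1 : ℚ) ^ (p / 2) * p) = Wf) :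
    ∃ D : ModularParametrizationData V (V.conductorNorm ℤ),
      ∀ Df : ModularParametrizationData Wf (Wf.conductorNorm ℤ),
        padicValNat p D.modularDegree < padicValNat p Df.modularDegree :=
  ManinFrameResidueProperTwistDegree.twistDegreeStep_of_exists_member_not_dvd_c hnf W (by omega) hadd
    hirr hisoV hG hV4 C hC (exists_member_not_dvd_c_of_tameTwist hK hnf W hp11 hadd hirr hA)

/-- **The per-curve certificate.** For `W/ℚ` globally minimal, additive at a prime `p > 7` with `E[p]`
irreducible and (A²) at the frame: EVERY lattice-optimal datum at level `N(W)` of EVERY globally minimal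
`W₀ ∼ W` has `p ∤ c₀` — GRANTED the fact; a congruence condition on `(N, a_ℓ)` alone (no `L`-value, no
modular degree, no period of `E`). [cite: Kato2004Asterisque, (8.1.3) (p. 180), Thm. 9.7 (p. 189)]
[cite: KimNakamura2020, Cor. 2.4] -/
theorem forall_latticeOptimal_not_dvd_c_of_tameTwist
    (hK : kato_neron_isIntegral_twistedSymbolSum_of_additive)
    (W : WeierstrassCurve ℚ) [W.IsElliptic] [W.IsGloballyMinimal] [NeZero (W.conductorNorm ℤ)]
    (hp7 : 7 < p) (hadd : Addv W p) (hirr : Irr W p)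
    (hA : ∀ ℓ ∈ (W.conductorNorm ℤ).primeFactors, ¬ ℓ ^ 2 ∣ W.conductorNorm ℤ →
      ∀ j : ℕ, ((ℓ : ZMod p) / (W.LFunction ℓ : ZMod p)) ^ 2 ^ j ≠ 1)
    (W₀ : WeierstrassCurve ℚ) [W₀.IsElliptic] [W₀.IsGloballyMinimal] (hiso : IsIsogenous W W₀)
    (D₀ : ModularParametrizationData W₀ (W.conductorNorm ℤ))
    (hopt : ∀ z ∈ D₀.L.lattice, ∃ w ∈ periodLattice D₀.f, z = D₀.c * w) :
    ¬ (p : ℤ) ∣ D₀.c := by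
  have hiso₀ : IsIsogenous W₀ W := hiso.symm_of_charZero
  have hL : W₀.LFunction = W.LFunction := hiso₀.LFunction_eq
  have hadd₀ : Addv W₀ p := (X2.addv_iff_of_isIsogenous (p := p) hiso).mp hadd
  have hirr₀ : Irr W₀ p := (X12.irr_iff_of_isIsogenous hiso p).mp hirr
  have hpN : p ^ 2 ∣ W.conductorNorm ℤ := sq_dvd_conductorNorm_of_not_good_of_not_mult hadd
  rw [← hL] at hA
  exact not_dvd_c_of_tameTwist hK W₀ D₀ hopt hp7 hadd₀ hirr₀ hpN hA

end Main

end Summit.BirchSwinnertonDyer.BirchSwinnertonDyer.Theorems.ManinFrameResidueProperRTameTwist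

end
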